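import Summits.Ventures.PercRepro.RankLevelSetRuleQSmallFlat

/-!
# PercRepro — (R̂) FROM THE TWO-TERM PAIRING: `2(u+2)·Π(q+2+i) ≤ [2(u+2) + (k−1)(#P−1)]·k·Π(u+2+i)`, EVERY `k ≥ 3`
(p4, gen 22; C-044; paper proofs/P4-CELL-THREE.md §11.8)

`rhat_ge_phiK_of_two (q k m) (3 ≤ k) (k − 1 ≤ q − m) (m ≤ q) (h2) : phiK (q + k) q ≤ rhat q k m`, where `h2` is ONE
inequality between products of `k − 1` integers: with `u = q − m`,
`2(u+2)·Π_{i<k−1}(q+2+i) ≤ [2(u+2) + (k−1)(m−1)]·k·Π_{i<k−1}(u+2+i)`.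
It is the row `J = 1` of the pairing of the `i = 0` row of `rhat_sub_phiK_eq` with the TWO top terms `i = k−1, k−2` of the
diagonal `J + k − 1`; the rows `J ≥ 2` follow from `J = 1` (`two_row_step`: with `W(J) = (u+2)(J+1) + (k−1)(m−J)` the shift
`J ↦ J+1` needs `W(J)(J+2)(q+J+k) ≤ W(J+1)(J+k)(q+J+1)`, whose difference is a polynomial in `(a, b, c, d)` —
`u = k−1+a`, `J = 1+b`, `m = J+1+c`, `k = 3+d` — with 38 non-negative coefficients, `two_step_poly`).  Compared with
RankLevelSetRuleQProdFlat (one term, `Π(1 + #P/(u+1+l)) ≤ k`, regime `#P ≲ q/3` at `k = 5`) the two-term condition reaches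
`#P ≈ q/2` (thresholds `u₀(m) ≈ m`, paper §11.7–11.8); the whole diagonal (`#P ≲ (k−1)q/k`) is RankLevelSetRuleQPairingCert's
per-point certificate, its uniform form open.  A certified point outside the one-term regime:
`rhat_hundred_five_fortyfive : phiK (100 + 5) 100 ≤ rhat 100 5 45` (`u = 55`: `2·57·102·103·104·105 = 13,078,709,280 ≤
(114 + 176)·5·57·58·59·60 = 16,969,698,000`, while the one-term condition `114,725,520 ≤ 5·11,703,240 = 58,516,200` fails).
Axioms: standard.
-/

namespace PercRepro

open Finset

/-- The row step of the TWO-term pairing as a polynomial inequality (`u = d + 2 + a`, `J = b + 1`, `m = b + 2 + c`,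
`k = d + 3`; `W(J) = (u+2)(J+1) + (k−1)(m−J)`): `W(J)·(J+2)·(q+J+k) ≤ W(J+1)·(J+k)·(q+J+1)` — the difference is a
polynomial in `(a, b, c, d)` with 38 non-negative coefficients. -/
lemma two_step_poly (a b c d : ℚ) (ha : 0 ≤ a) (hb : 0 ≤ b) (hc : 0 ≤ c) (hd : 0 ≤ d) :
    ((d + a + 4) * (b + 2) + (d + 2) * (c + 1)) * (b + 3) * ((d + 2 + a) + (b + 2 + c) + (b + 1) + (d + 3))
      ≤ ((d + a + 4) * (b + 3) + (d + 2) * c) * ((b + 1) + (d + 3)) * ((d + 2 + a) + (b + 2 + c) + (b + 1) + 1) := by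
  rw [← sub_nonneg]
  have key : ((d + a + 4) * (b + 3) + (d + 2) * c) * ((b + 1) + (d + 3)) * ((d + 2 + a) + (b + 2 + c) + (b + 1) + 1)
      - ((d + a + 4) * (b + 2) + (d + 2) * (c + 1)) * (b + 3) * ((d + 2 + a) + (b + 2 + c) + (b + 1) + (d + 3))
      = 48 + 60 * d + 24 * d ^ 2 + 3 * d ^ 3 + 18 * c + 23 * c * d + 9 * c * d ^ 2 + 1 * c * d ^ 3 + 2 * c ^ 2 + 3 * c ^ 2 * d + 1 * c ^ 2 * d ^ 2 + 28 * b + 32 * b * d + 11 * b * d ^ 2 + 1 * b * d ^ 3 + 6 * b * c + 7 * b * c * d + 2 * b * c * d ^ 2 + 4 * b ^ 2 + 4 * b ^ 2 * d + 1 * b ^ 2 * d ^ 2 + 42 * a + 33 * a * d + 6 * a * d ^ 2 + 8 * a * c + 6 * a * c * d + 1 * a * c * d ^ 2 + 20 * a * b + 14 * a * b * d + 2 * a * b * d ^ 2 + 2 * a * b * c + 1 * a * b * c * d + 2 * a * b ^ 2 + 1 * a * b ^ 2 * d + 6 * a ^ 2 + 3 * a ^ 2 * d + 2 * a ^ 2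 * b + 1 * a ^ 2 * b * d := by
    ring
  rw [key]
  positivity

/-- The row step in `ℕ` (same variables). -/
lemma two_step_nat (a b c d : ℕ) :
    ((d + a + 4) * (b + 2) + (d + 2) * (c + 1)) * (b + 3) * ((d + 2 + a) + (b + 2 + c) + (b + 1) + (d + 3))
      ≤ ((d + a + 4) * (b + 3) + (d + 2) * c) * ((b + 1) + (d + 3)) * ((d + 2 + a) + (b + 2 + c) + (b + 1) + 1) := by
  have h := two_step_poly (a : ℚ) (b : ℚ) (c : ℚ) (d : ℚ) (by positivity) (by positivity) (by positivity) (by positivity)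
  exact_mod_cast h


/-- The shifted products: `Π_{i<r}(c + 1 + i)·c = Π_{i<r}(c + i)·(c + r)`. -/
lemma prod_shift (c r : ℕ) : (∏ i ∈ range r, (c + 1 + i)) * c = (∏ i ∈ range r, (c + i)) * (c + r) := by
  have h1 := Finset.prod_range_succ (fun i => c + i) r
  have h2 := Finset.prod_range_succ' (fun i => c + i) r
  have h3 : ∏ i ∈ range r, (c + (i + 1)) = ∏ i ∈ range r, (c + 1 + i) := Finset.prod_congr rfl (fun i _ => by ring)
  beta_reduce at h1 h2
  rw [h3, add_zero] at h2
  linarith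

/-- The row condition of the two-term pairing at row `J` (`W(J) = (u+2)(J+1) + (k−1)(m−J)`, `r = k − 1`):
`W(J)·Π(u+2+i)·Π(J+1+i) ≥ (u+2)(J+1)·Π(1+i)·Π(u+m+J+1+i)`; the step `J ↦ J + 1` (for `J + 1 ≤ m`). -/
lemma two_row_step (u m J k : ℕ) (hJ : 1 ≤ J) (hJm : J + 1 ≤ m) (hk : 3 ≤ k) (hu : k - 1 ≤ u)
    (h : (u + 2) * (J + 1) * (∏ i ∈ range (k - 1), (1 + i)) * ∏ i ∈ range (k - 1), (u + m + J + 1 + i)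
        ≤ ((u + 2) * (J + 1) + (k - 1) * (m - J)) * (∏ i ∈ range (k - 1), (u + 2 + i)) * ∏ i ∈ range (k - 1), (J + 1 + i)) :
    (u + 2) * (J + 1 + 1) * (∏ i ∈ range (k - 1), (1 + i)) * ∏ i ∈ range (k - 1), (u + m + (J + 1) + 1 + i)
        ≤ ((u + 2) * (J + 1 + 1) + (k - 1) * (m - (J + 1))) * (∏ i ∈ range (k - 1), (u + 2 + i))
            * ∏ i ∈ range (k - 1), (J + 1 + 1 + i) := by
  obtain ⟨d, rfl⟩ : ∃ d, k = d + 3 := ⟨k - 3, by omega⟩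
  obtain ⟨a, rfl⟩ : ∃ a, u = d + 2 + a := ⟨u - (d + 2), by omega⟩
  obtain ⟨b, rfl⟩ : ∃ b, J = b + 1 := ⟨J - 1, by omega⟩
  obtain ⟨c, rfl⟩ : ∃ c, m = b + 2 + c := ⟨m - (b + 2), by omega⟩
  rw [show d + 3 - 1 = d + 2 by omega] at h ⊢
  rw [show b + 2 + c - (b + 1) = c + 1 by omega] at h
  rw [show b + 2 + c - (b + 1 + 1) = c by omega]
  set Pu := ∏ i ∈ range (d + 2), (d + 2 + a + 2 + i)
  set P1 := ∏ i ∈ range (d + 2), (1 + i)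
  set PJ := ∏ i ∈ range (d + 2), (b + 1 + 1 + i)
  set PJ' := ∏ i ∈ range (d + 2), (b + 1 + 1 + 1 + i)
  set Pq := ∏ i ∈ range (d + 2), (d + 2 + a + (b + 2 + c) + (b + 1) + 1 + i)
  set Pq' := ∏ i ∈ range (d + 2), (d + 2 + a + (b + 2 + c) + (b + 1 + 1) + 1 + i)
  have eJ : PJ' * (b + 1 + 1) = PJ * (b + 1 + 1 + (d + 2)) := by
    have := prod_shift (b + 1 + 1) (d + 2)
    simpa only [PJ, PJ'] using this
  have eq : Pq' * (d + 2 + a + (b + 2 + c) + (b + 1) + 1)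
      = Pq * (d + 2 + a + (b + 2 + c) + (b + 1) + 1 + (d + 2)) := by
    have := prod_shift (d + 2 + a + (b + 2 + c) + (b + 1) + 1) (d + 2)
    have e : ∏ i ∈ range (d + 2), (d + 2 + a + (b + 2 + c) + (b + 1) + 1 + 1 + i) = Pq' :=
      Finset.prod_congr rfl (fun i _ => by ring)
    rw [e] at this
    exact this
  have hstep := two_step_nat a b c d
  -- multiply the target by (b+2)·(q+J+1)·W(J) and use h and hstep
  have hW : 0 < (d + 2 + a + 2) * (b + 1 + 1) + (d + 2) * (c + 1) := by positivity
  have hpos : 0 < (b + 1 + 1) * (d + 2 + a + (b + 2 + c) + (b + 1) + 1) := by positivity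
  refine Nat.le_of_mul_le_mul_right ?_ hpos
  refine Nat.le_of_mul_le_mul_right ?_ hW
  calc (d + 2 + a + 2) * (b + 1 + 1 + 1) * P1 * Pq' * ((b + 1 + 1) * (d + 2 + a + (b + 2 + c) + (b + 1) + 1))
        * ((d + 2 + a + 2) * (b + 1 + 1) + (d + 2) * (c + 1))
      = (d + 2 + a + 2) * (b + 1 + 1 + 1) * P1 * (Pq' * (d + 2 + a + (b + 2 + c) + (b + 1) + 1)) * (b + 1 + 1)
        * ((d + 2 + a + 2) * (b + 1 + 1) + (d + 2) * (c + 1)) := by ring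
    _ = (d + 2 + a + 2) * (b + 1 + 1 + 1) * P1 * (Pq * (d + 2 + a + (b + 2 + c) + (b + 1) + 1 + (d + 2))) * (b + 1 + 1)
        * ((d + 2 + a + 2) * (b + 1 + 1) + (d + 2) * (c + 1)) := by rw [eq]
    _ = ((d + 2 + a + 2) * (b + 1 + 1) * P1 * Pq)
        * (((d + 2 + a + 2) * (b + 1 + 1) + (d + 2) * (c + 1)) * (b + 1 + 1 + 1)
          * (d + 2 + a + (b + 2 + c) + (b + 1) + 1 + (d + 2))) := by ring
    _ ≤ (((d + 2 + a + 2) * (b + 1 + 1) + (d + 2) * (c + 1)) * Pu * PJ)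
        * (((d + 2 + a + 2) * (b + 1 + 1 + 1) + (d + 2) * c) * (b + 1 + (d + 3))
          * (d + 2 + a + (b + 2 + c) + (b + 1) + 1)) := by
        refine Nat.mul_le_mul h ?_
        have := hstep
        calc ((d + 2 + a + 2) * (b + 1 + 1) + (d + 2) * (c + 1)) * (b + 1 + 1 + 1)
              * (d + 2 + a + (b + 2 + c) + (b + 1) + 1 + (d + 2))
            = ((d + a + 4) * (b + 2) + (d + 2) * (c + 1)) * (b + 3) * ((d + 2 + a) + (b + 2 + c) + (b + 1) + (d + 3)) := by
              ring
          _ ≤ ((d + a + 4) * (b + 3) + (d + 2) * c) * ((b + 1) + (d + 3)) * ((d + 2 + a) + (b + 2 + c) + (b + 1) + 1) :=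
              this
          _ = ((d + 2 + a + 2) * (b + 1 + 1 + 1) + (d + 2) * c) * (b + 1 + (d + 3))
              * (d + 2 + a + (b + 2 + c) + (b + 1) + 1) := by ring
    _ = ((d + 2 + a + 2) * (b + 1 + 1 + 1) + (d + 2) * c) * Pu * (PJ * (b + 1 + 1 + (d + 2)))
        * (d + 2 + a + (b + 2 + c) + (b + 1) + 1) * ((d + 2 + a + 2) * (b + 1 + 1) + (d + 2) * (c + 1)) := by ring
    _ = ((d + 2 + a + 2) * (b + 1 + 1 + 1) + (d + 2) * c) * Pu * (PJ' * (b + 1 + 1))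
        * (d + 2 + a + (b + 2 + c) + (b + 1) + 1) * ((d + 2 + a + 2) * (b + 1 + 1) + (d + 2) * (c + 1)) := by rw [eJ]
    _ = ((d + 2 + a + 2) * (b + 1 + 1 + 1) + (d + 2) * c) * Pu * PJ'
        * ((b + 1 + 1) * (d + 2 + a + (b + 2 + c) + (b + 1) + 1)) * ((d + 2 + a + 2) * (b + 1 + 1) + (d + 2) * (c + 1)) := by
        ring


/-- From the row `J = 1` (the hypothesis) to every row `1 ≤ J ≤ m` of the two-term pairing. -/
lemma two_row_all (u m k : ℕ) (hk : 3 ≤ k) (hu : k - 1 ≤ u)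
    (h2 : 2 * (u + 2) * ∏ i ∈ range (k - 1), (u + m + 2 + i)
        ≤ ((u + 2) * 2 + (k - 1) * (m - 1)) * k * ∏ i ∈ range (k - 1), (u + 2 + i)) :
    ∀ J, 1 ≤ J → J ≤ m →
      (u + 2) * (J + 1) * (∏ i ∈ range (k - 1), (1 + i)) * ∏ i ∈ range (k - 1), (u + m + J + 1 + i)
        ≤ ((u + 2) * (J + 1) + (k - 1) * (m - J)) * (∏ i ∈ range (k - 1), (u + 2 + i)) * ∏ i ∈ range (k - 1), (J + 1 + i) := by
  intro J hJ hJm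
  induction J with
  | zero => omega
  | succ J ih =>
    rcases Nat.eq_zero_or_pos J with h0 | hpos
    · subst h0
      have e : ∏ i ∈ range (k - 1), (0 + 1 + 1 + i) = k * ∏ i ∈ range (k - 1), (1 + i) := by
        have := prod_shift 1 (k - 1)
        rw [mul_one, show 1 + (k - 1) = k by omega] at this
        have e' : ∏ i ∈ range (k - 1), (0 + 1 + 1 + i) = ∏ i ∈ range (k - 1), (1 + 1 + i) :=
          Finset.prod_congr rfl (fun i _ => by ring)
        rw [e', this]; ring
      have e2 : ∏ i ∈ range (k - 1), (u + m + (0 + 1) + 1 + i) = ∏ i ∈ range (k - 1), (u + m + 2 + i) :=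
        Finset.prod_congr rfl (fun i _ => by ring)
      rw [e, e2]
      calc (u + 2) * (0 + 1 + 1) * (∏ i ∈ range (k - 1), (1 + i)) * ∏ i ∈ range (k - 1), (u + m + 2 + i)
          = (2 * (u + 2) * ∏ i ∈ range (k - 1), (u + m + 2 + i)) * ∏ i ∈ range (k - 1), (1 + i) := by ring
        _ ≤ (((u + 2) * 2 + (k - 1) * (m - 1)) * k * ∏ i ∈ range (k - 1), (u + 2 + i)) * ∏ i ∈ range (k - 1), (1 + i) :=
            Nat.mul_le_mul_right _ h2
        _ = ((u + 2) * (0 + 1 + 1) + (k - 1) * (m - (0 + 1))) * (∏ i ∈ range (k - 1), (u + 2 + i))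
              * (k * ∏ i ∈ range (k - 1), (1 + i)) := by ring
    · exact two_row_step u m J k hpos hJm hk hu (ih hpos (by omega))

/-- The two-term pairing in `ℕ` (row `J' ≤ m`, `q = u + m`, `n = u + k`, `3 ≤ k`):
`C(m,J')·C(q+J'+k−1, J'+k−1) ≤ [C(n,k−1)·C(m,J') + C(n,k−2)·C(m,J'+1)]·C(q+J', J')`. -/
lemma pairing_choose_two (u m J' k : ℕ) (hk : 3 ≤ k) (hu : k - 1 ≤ u) (hJ : 1 ≤ J') (hJm : J' ≤ m)
    (h2 : 2 * (u + 2) * ∏ i ∈ range (k - 1), (u + m + 2 + i)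
        ≤ ((u + 2) * 2 + (k - 1) * (m - 1)) * k * ∏ i ∈ range (k - 1), (u + 2 + i)) :
    m.choose J' * (u + m + J' + (k - 1)).choose (J' + (k - 1))
      ≤ ((u + k).choose (k - 1) * m.choose J' + (u + k).choose (k - 2) * m.choose (J' + 1)) * (u + m + J').choose J' := by
  have hT := two_row_all u m k hk hu h2 J' hJ hJm
  obtain ⟨r, rfl⟩ : ∃ r, k = r + 2 := ⟨k - 2, by omega⟩
  rw [show r + 2 - 1 = r + 1 by omega] at hT ⊢
  rw [show r + 2 - 2 = r by omega]
  have hA := choose_add_mul_prod (u + m + J') J' (r + 1)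
  have hB := choose_add_mul_prod (u + 1) 0 (r + 1)
  rw [Nat.choose_zero_right, one_mul, zero_add] at hB
  rw [show u + 1 + (r + 1) = u + (r + 2) by ring] at hB
  -- C(n, r)·(u+2) = C(n, r+1)·(r+1)
  have c1 : (u + (r + 2)).choose (r + 1) * (r + 1) = (u + (r + 2)).choose r * (u + 2) := by
    have := Nat.choose_succ_right_eq (u + (r + 2)) r
    rw [show u + (r + 2) - r = u + 2 by omega] at this
    exact this
  -- C(m, J'+1)·(J'+1) = C(m, J')·(m − J')
  have c2 : m.choose (J' + 1) * (J' + 1) = m.choose J' * (m - J') := Nat.choose_succ_right_eq m J'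
  have hpos : 0 < (u + 2) * (J' + 1) * ((∏ i ∈ range (r + 1), (J' + 1 + i)) * ∏ i ∈ range (r + 1), (1 + i)) := by
    positivity
  refine Nat.le_of_mul_le_mul_right ?_ hpos
  have key : (u + m + J' + (r + 1)).choose (J' + (r + 1)) * ((u + 2) * (J' + 1))
        * ((∏ i ∈ range (r + 1), (J' + 1 + i)) * ∏ i ∈ range (r + 1), (1 + i))
      ≤ (u + (r + 2)).choose (r + 1) * ((u + 2) * (J' + 1) + (r + 1) * (m - J')) * (u + m + J').choose J'
        * ((∏ i ∈ range (r + 1), (J' + 1 + i)) * ∏ i ∈ range (r + 1), (1 + i)) := by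
    calc (u + m + J' + (r + 1)).choose (J' + (r + 1)) * ((u + 2) * (J' + 1))
          * ((∏ i ∈ range (r + 1), (J' + 1 + i)) * ∏ i ∈ range (r + 1), (1 + i))
        = ((u + m + J' + (r + 1)).choose (J' + (r + 1)) * ∏ i ∈ range (r + 1), (J' + 1 + i))
          * ((u + 2) * (J' + 1) * ∏ i ∈ range (r + 1), (1 + i)) := by ring
      _ = ((u + m + J').choose J' * ∏ i ∈ range (r + 1), (u + m + J' + 1 + i))
          * ((u + 2) * (J' + 1) * ∏ i ∈ range (r + 1), (1 + i)) := by rw [hA]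
      _ = (u + m + J').choose J' * ((u + 2) * (J' + 1) * (∏ i ∈ range (r + 1), (1 + i))
          * ∏ i ∈ range (r + 1), (u + m + J' + 1 + i)) := by ring
      _ ≤ (u + m + J').choose J' * (((u + 2) * (J' + 1) + (r + 1) * (m - J')) * (∏ i ∈ range (r + 1), (u + 2 + i))
          * ∏ i ∈ range (r + 1), (J' + 1 + i)) := Nat.mul_le_mul_left _ hT
      _ = (u + m + J').choose J' * (((u + 2) * (J' + 1) + (r + 1) * (m - J'))
          * ((u + (r + 2)).choose (r + 1) * ∏ i ∈ range (r + 1), (1 + i)) * ∏ i ∈ range (r + 1), (J' + 1 + i)) := by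
          rw [hB]
      _ = (u + (r + 2)).choose (r + 1) * ((u + 2) * (J' + 1) + (r + 1) * (m - J')) * (u + m + J').choose J'
          * ((∏ i ∈ range (r + 1), (J' + 1 + i)) * ∏ i ∈ range (r + 1), (1 + i)) := by ring
  calc m.choose J' * (u + m + J' + (r + 1)).choose (J' + (r + 1))
        * ((u + 2) * (J' + 1) * ((∏ i ∈ range (r + 1), (J' + 1 + i)) * ∏ i ∈ range (r + 1), (1 + i)))
      = m.choose J' * ((u + m + J' + (r + 1)).choose (J' + (r + 1)) * ((u + 2) * (J' + 1))
        * ((∏ i ∈ range (r + 1), (J' + 1 + i)) * ∏ i ∈ range (r + 1), (1 + i))) := by ring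
    _ ≤ m.choose J' * ((u + (r + 2)).choose (r + 1) * ((u + 2) * (J' + 1) + (r + 1) * (m - J')) * (u + m + J').choose J'
        * ((∏ i ∈ range (r + 1), (J' + 1 + i)) * ∏ i ∈ range (r + 1), (1 + i))) := Nat.mul_le_mul_left _ key
    _ = ((u + (r + 2)).choose (r + 1) * m.choose J' * ((u + 2) * (J' + 1))
        + (u + (r + 2)).choose (r + 1) * (r + 1) * (m.choose J' * (m - J'))) * (u + m + J').choose J'
        * ((∏ i ∈ range (r + 1), (J' + 1 + i)) * ∏ i ∈ range (r + 1), (1 + i)) := by ring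
    _ = ((u + (r + 2)).choose (r + 1) * m.choose J' * ((u + 2) * (J' + 1))
        + (u + (r + 2)).choose r * (u + 2) * (m.choose (J' + 1) * (J' + 1))) * (u + m + J').choose J'
        * ((∏ i ∈ range (r + 1), (J' + 1 + i)) * ∏ i ∈ range (r + 1), (1 + i)) := by rw [c1, c2]
    _ = ((u + (r + 2)).choose (r + 1) * m.choose J' + (u + (r + 2)).choose r * m.choose (J' + 1)) * (u + m + J').choose J'
        * ((u + 2) * (J' + 1) * ((∏ i ∈ range (r + 1), (J' + 1 + i)) * ∏ i ∈ range (r + 1), (1 + i))) := by ring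


/-- The two-term pairing in `ℚ`: `C(m,J+1)·A(J+1) ≤ A(k+J)·[C(n,k−1)·C(m,J+1) + C(n,k−2)·C(m,J+2)]`, every `J`. -/
lemma pair_term_two (u m k J : ℕ) (hk : 3 ≤ k) (hu : k - 1 ≤ u)
    (h2 : 2 * (u + 2) * ∏ i ∈ range (k - 1), (u + m + 2 + i)
        ≤ ((u + 2) * 2 + (k - 1) * (m - 1)) * k * ∏ i ∈ range (k - 1), (u + 2 + i)) :
    (m.choose (J + 1) : ℚ) * (1 / ((u + m + (J + 1)).choose (J + 1) : ℚ))
      ≤ (1 / ((u + m + (k + J)).choose (k + J) : ℚ))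
        * (((u + k).choose (k - 1) : ℚ) * (m.choose (J + 1) : ℚ) + ((u + k).choose (k - 2) : ℚ) * (m.choose (J + 2) : ℚ)) := by
  rcases Nat.lt_or_ge m (J + 1) with hJm | hJm
  · rw [Nat.choose_eq_zero_of_lt hJm]
    push_cast
    rw [zero_mul]
    positivity
  · have h := pairing_choose_two u m (J + 1) k hk hu (by omega) hJm h2
    rw [show u + m + (J + 1) + (k - 1) = u + m + (k + J) by omega, show J + 1 + (k - 1) = k + J by omega,
      show J + 1 + 1 = J + 2 by ring] at h
    have hX : (0 : ℚ) < ((u + m + (J + 1)).choose (J + 1) : ℚ) := by exact_mod_cast Nat.choose_pos (by omega)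
    have hY : (0 : ℚ) < ((u + m + (k + J)).choose (k + J) : ℚ) := by exact_mod_cast Nat.choose_pos (by omega)
    have h' : ((m.choose (J + 1) : ℕ) : ℚ) * ((u + m + (k + J)).choose (k + J) : ℚ)
        ≤ ((((u + k).choose (k - 1) * m.choose (J + 1) + (u + k).choose (k - 2) * m.choose (J + 2) : ℕ)) : ℚ)
          * ((u + m + (J + 1)).choose (J + 1) : ℚ) := by exact_mod_cast h
    push_cast at h'
    rw [mul_one_div, one_div_mul_eq_div, div_le_div_iff₀ hX hY]
    linarith

/-- **(R̂) FROM THE TWO-TERM PAIRING, EVERY `k ≥ 3`**: if `2(u+2)·Π_{i<k−1}(q+2+i) ≤ [2(u+2) + (k−1)(#P−1)]·k·Π_{i<k−1}(u+2+i)`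
(`u = q − #P`; the row `J = 1` of the pairing with the two top terms `i = k−1, k−2` of each diagonal) and `#P ≤ q − k + 1`,
then `Φ(q+k, q) ≤ R̂(q, k, #P)`. -/
theorem rhat_ge_phiK_of_two (q k m : ℕ) (hk : 3 ≤ k) (hu : k - 1 ≤ q - m) (hm : m ≤ q)
    (h2 : 2 * (q - m + 2) * ∏ i ∈ range (k - 1), (q + 2 + i)
        ≤ ((q - m + 2) * 2 + (k - 1) * (m - 1)) * k * ∏ i ∈ range (k - 1), (q - m + 2 + i)) :
    phiK (q + k) q ≤ rhat q k m := by
  rw [rhat_ge_phiK_iff_untrunc q k m (by omega) hu hm]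
  obtain ⟨u, rfl⟩ : ∃ u, q = u + m := ⟨q - m, by omega⟩
  rw [Nat.add_sub_cancel] at h2 hu
  -- the two top terms of every diagonal J' ≥ k
  have hterm : ∀ J' i, i ≤ J' →
      (if i ≤ J' ∧ J' - i ≤ m then ((u + m + k - m).choose i : ℚ) * (m.choose (J' - i) : ℚ) else 0)
        = ((u + k).choose i : ℚ) * (m.choose (J' - i) : ℚ) := by
    intro J' i hi
    rw [show u + m + k - m = u + k by omega]
    by_cases hm' : J' - i ≤ m
    · rw [if_pos ⟨hi, hm'⟩]
    · rw [if_neg (fun h => hm' h.2), Nat.choose_eq_zero_of_lt (by omega : m < J' - i)]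
      simp
  have hN : ∀ J ∈ range m,
      (1 / ((u + m + (k + J)).choose (k + J) : ℚ))
          * (((u + k).choose (k - 1) : ℚ) * (m.choose (J + 1) : ℚ) + ((u + k).choose (k - 2) : ℚ) * (m.choose (J + 2) : ℚ))
        ≤ (1 / ((u + m + (k + J)).choose (k + J) : ℚ)) * ∑ i ∈ Ioo 0 k,
            (if i ≤ k + J ∧ k + J - i ≤ m then ((u + m + k - m).choose i : ℚ) * (m.choose (k + J - i) : ℚ) else 0) := by
    intro J _
    refine mul_le_mul_of_nonneg_left ?_ (by positivity)
    have hsub : ({k - 2, k - 1} : Finset ℕ) ⊆ Ioo 0 k := by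
      intro i hi
      simp only [Finset.mem_insert, Finset.mem_singleton] at hi
      rw [Finset.mem_Ioo]; omega
    refine le_trans (le_of_eq ?_) (Finset.sum_le_sum_of_subset_of_nonneg hsub (fun i _ _ => by split_ifs <;> positivity))
    rw [Finset.sum_pair (show k - 2 ≠ k - 1 by omega), hterm (k + J) (k - 2) (by omega), hterm (k + J) (k - 1) (by omega),
      show k + J - (k - 2) = J + 2 by omega, show k + J - (k - 1) = J + 1 by omega]
    ring
  have hpos : ∑ J ∈ range m, (1 / ((u + m + (k + J)).choose (k + J) : ℚ))
        * (((u + k).choose (k - 1) : ℚ) * (m.choose (J + 1) : ℚ) + ((u + k).choose (k - 2) : ℚ) * (m.choose (J + 2) : ℚ))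
      ≤ ∑ J' ∈ Ico k (k + m), (1 / ((u + m + J').choose J' : ℚ)) * ∑ i ∈ Ioo 0 k,
            (if i ≤ J' ∧ J' - i ≤ m then ((u + m + k - m).choose i : ℚ) * (m.choose (J' - i) : ℚ) else 0) := by
    rw [Finset.sum_Ico_eq_sum_range, show k + m - k = m by omega]
    exact Finset.sum_le_sum hN
  rw [sum_Ioo_nat, show k - (0 + 1) = k - 1 by omega]
  refine le_trans ?_ hpos
  set f : ℕ → ℚ := fun J => (m.choose (0 + 1 + J) : ℚ) * (1 / ((u + m + (0 + 1 + J)).choose (0 + 1 + J) : ℚ)) with hf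
  set g : ℕ → ℚ := fun J => (1 / ((u + m + (k + J)).choose (k + J) : ℚ))
        * (((u + k).choose (k - 1) : ℚ) * (m.choose (J + 1) : ℚ) + ((u + k).choose (k - 2) : ℚ) * (m.choose (J + 2) : ℚ)) with hg
  have hfg : ∀ J, f J ≤ g J := by
    intro J
    simp only [hf, hg, show 0 + 1 + J = J + 1 by ring]
    exact pair_term_two u m k J hk hu h2
  have hg0 : ∀ J, m ≤ J → g J = 0 := by
    intro J hJ
    simp only [hg]
    rw [Nat.choose_eq_zero_of_lt (by omega : m < J + 1), Nat.choose_eq_zero_of_lt (by omega : m < J + 2)]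
    simp
  have hgnn : ∀ J, 0 ≤ g J := by
    intro J
    simp only [hg]
    positivity
  calc ∑ J ∈ range (k - 1), f J ≤ ∑ J ∈ range (k - 1), g J := Finset.sum_le_sum (fun J _ => hfg J)
    _ ≤ ∑ J ∈ range (k - 1 + m), g J :=
        Finset.sum_le_sum_of_subset_of_nonneg
          (fun x hx => by rw [Finset.mem_range] at hx ⊢; omega) (fun J _ _ => hgnn J)
    _ = ∑ J ∈ range m, g J := by
        rw [← Finset.sum_range_add_sum_Ico _ (show m ≤ k - 1 + m by omega)]
        rw [Finset.sum_eq_zero (fun J hJ => hg0 J (Finset.mem_Ico.1 hJ).1), add_zero]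


variable {α : Type} (M : Matroid α) [M.Finite]

/-- **Rule Q pays `Φ(q+k, q)` to every member whose flat part satisfies the two-term condition**, every `k ≥ 3`. -/
theorem ruleQRecv_ge_of_flatPart_two {q k : ℕ} (hk : 3 ≤ k) (hE : M.E.ncard = (q + k) + q)
    {Z : Set α} (hZ : Z ∈ cellMembers M (q + k) q) (hu : k - 1 ≤ q - (flatPart M Z).ncard)
    (h2 : 2 * (q - (flatPart M Z).ncard + 2) * ∏ i ∈ range (k - 1), (q + 2 + i)
        ≤ ((q - (flatPart M Z).ncard + 2) * 2 + (k - 1) * ((flatPart M Z).ncard - 1)) * k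
            * ∏ i ∈ range (k - 1), (q - (flatPart M Z).ncard + 2 + i)) :
    phiK (q + k) q ≤ ruleQRecv M (q + k) q Z := by
  refine le_trans ?_ (rhat_le_ruleQRecv M hE hZ)
  have hm : (flatPart M Z).ncard ≤ q :=
    (Nat.lt_of_sub_pos (lt_of_lt_of_le (show 0 < k - 1 by omega) hu)).le
  exact rhat_ge_phiK_of_two q k _ hk hu hm h2

/-- A certified point outside the one-term regime: `#P = 45` of the cell `(105, 100)` (`k = 5`, `u = 55`). -/
theorem rhat_hundred_five_fortyfive : phiK (100 + 5) 100 ≤ rhat 100 5 45 :=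
  rhat_ge_phiK_of_two 100 5 45 (by norm_num) (by norm_num) (by norm_num) (by decide)

end PercRepro
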